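import Summits.HodgeConjecture.HodgeConjecture.Theses.QbarEnvelope
import Literature.AlgebraicGeometry.FundamentalGroup.RiemannExistenceSmoothAffine
import HarnessLib

/-!
# Crux `Envelope` (stmt-HodgeConjecture-1069), line `birth` — registered stub
# `stub_locallyAlgebraicSeparatingSmoothAffineDimGeTwo`, CLOSED by the tree's Riemann-existence core

Route `QbarEnvelope` of `HodgeConjecture`. The registered skeleton `Cruxes/Envelope/Lines/birth.lean`
isolates, as the one transcendental input of Riemann existence with `ℚ̄`-descent (SGA 1 XII 5.1 + XIII 4.6)
in relative dimension `≥ 2`, the existence of a LOCALLY ALGEBRAIC SEPARATING FUNCTION for a finite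
topological covering `q : T → S(ℂ)` of a smooth irreducible affine `ℂ`-scheme `S` of relative dimension
`n + 2`: near any `P₀ ∈ S(ℂ)` there are an affine open `U ∋ P₀`, a continuous `h : q⁻¹(U) → ℂ` and a
non-zero polynomial `F ∈ Γ(S, U)[w]` with `F(q t)(h t) = 0` on `q⁻¹(U)` and `h` injective on the fibre
`q⁻¹(P₀)`. This is, VERBATIM up to instance binders, the tree theorem
`FundamentalGroup.SmoothAffine.exists_locallyAlgebraicSeparating`
(`Literature/AlgebraicGeometry/FundamentalGroup/RiemannExistenceSmoothAffine.lean`, 2026-08-17: étale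
coordinates, analytic inverse function theorem, the separating polynomial of the symmetric functions of a
generic linear form on the fibre), which is stated for EVERY smooth affine irreducible `S` (any relative
dimension); the stub is its specialisation to `SmoothOfRelativeDimension (n + 2)`, smoothness being read off
the relative-dimension hypothesis (`SmoothOfRelativeDimension.smooth`). Landed after the skeleton was
registered and never credited to the stub; this file records the registered signature. The same stub
(same name, same signature) is registered on crux `MiddleDivisorSupportFourfold`
(stmt-HodgeConjecture-2409, line `IdeatorFiveSketch`); see the companion file
`LinearSystemTorelliMiddleDivisorSupportFourfoldStubLocallyAlgebraicSeparating`.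

## References

* [SGA1] A. Grothendieck, M. Raynaud, Revêtements étales et groupe fondamental (SGA 1), LNM 224 (1971),
  Exp. XII Thm. 5.1, Exp. XIII Cor. 4.6.
* [HatcherAT2002] A. Hatcher, Algebraic Topology (2002), Thm. 1.38.
-/

noncomputable section

-- `Summit.HodgeConjecture.HodgeConjecture.…` is the mandated namespace (single-conjunct summit).
set_option linter.dupNamespace false

namespace Summit.HodgeConjecture.HodgeConjecture.Theorems.Envelope

open AlgebraicGeometry Literature.AlgebraicGeometry.Motives

/-- **Registered stub `stub_locallyAlgebraicSeparatingSmoothAffineDimGeTwo` of the line `birth`** (crux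
`Envelope`, stmt-HodgeConjecture-1069), verbatim: for a smooth irreducible affine `ℂ`-scheme `S` of relative
dimension `n + 2`, a finite topological covering `q : T → S(ℂ)` and `P₀ ∈ S(ℂ)`, there are an affine open
`U ∋ P₀`, a function `h : T → ℂ` continuous on `q⁻¹(U)` and a non-zero polynomial `F` over `Γ(S, U)` with
`F(q t)(h t) = 0` for `q t ∈ U` and `h` injective on `q⁻¹(P₀)`. The tree theorem
`FundamentalGroup.SmoothAffine.exists_locallyAlgebraicSeparating` in relative dimension `n + 2`.
[cite: SGA1, Exp. XII Thm. 5.1] [cite: HatcherAT2002, Thm. 1.38] -/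
theorem stub_locallyAlgebraicSeparatingSmoothAffineDimGeTwo :
    ∀ (n : ℕ) (S : SchemeOver ℂ), IsAffine S.left → SmoothOfRelativeDimension (n + 2) S.hom →
      IrreducibleSpace S.left →
      ∀ (T : Type) [TopologicalSpace T] (q : T → ComplexPoints S) (_ : IsCoveringMap q)
        (_ : ∀ t, (q ⁻¹' {t}).Finite) (P₀ : ComplexPoints S),
        ∃ (U : S.left.Opens) (_ : IsAffineOpen U) (_ : P₀.pt ∈ U) (h : T → ℂ)
          (F : Polynomial Γ(S.left, U)),
          ContinuousOn h (q ⁻¹' {P | P.pt ∈ U}) ∧ F ≠ 0 ∧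
          (∀ (t : T) (ht : (q t).pt ∈ U), (F.map ((q t).evalRingHom U ht)).eval (h t) = 0) ∧
          Set.InjOn h (q ⁻¹' {P₀}) := by
  intro n S hAff hSm hIrr T _ q hq hfin P₀
  haveI := hAff
  haveI := hIrr
  haveI := hSm
  haveI : Smooth S.hom := SmoothOfRelativeDimension.smooth (n + 2) S.hom
  exact Literature.AlgebraicGeometry.FundamentalGroup.SmoothAffine.exists_locallyAlgebraicSeparating
    S T q hq hfin P₀

end Summit.HodgeConjecture.HodgeConjecture.Theorems.Envelope

end
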